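import Summits.BirchSwinnertonDyer.BirchSwinnertonDyer.Theorems.PrintX9MuPartKSLettersAnyClassNumber
import Summits.BirchSwinnertonDyer.BirchSwinnertonDyer.Theorems.PrintX9StabilizedClassOfKolyvaginSystemLeaf
import Summits.BirchSwinnertonDyer.BirchSwinnertonDyer.Theorems.PrintX9KummerStrictOnFrames
import HarnessLib

/-!
# The KS μ-chain is CLASS-NUMBER-FREE, III: the cyclic port and the coherent-pair μ-letter (with torsion) from Howard Thm. 1.6.1
# + CGLS Thm. 4.1.1 for ANY class number, modulo the control-glue letter without its idle binders

Cell `run/shared/lean/pub/bsd-print-x9/`, seat bsd-line-x10b-p1 LEAD g11; `--supports stmt-BirchSwinnertonDyer-23055` (helper). THEOREMS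
ONLY (no definition, no `abbrev`, no named fact, no instance, no `sorry`); no `Theses` import (route-free).

Part III of the re-thread announced in `PrintX9MuPartKSLettersAnyClassNumber` (part I, STUB A side; FINDING «hhK-IDLE»: the binders
`¬ W.HasCM`, `MastellaZerman2026.HasPadicScalarImage W p`, `p ∣ NumberField.classNumber K` of the KS μ-chain letters are used by no
proof). Part II — the control-glue side `controlGlueKS_anyClassNumber` (the letter `HeegnerMuPartControlGlue.Stmt.controlGlueKS` with
the three idle binders deleted, from the (B4)/(B5) readout stubs whose proofs ignore them) — is x10b-p1-w8 g9's file
`PrintX10bControlGlueKSAnyClassNumber`; HERE that statement is taken as the HYPOTHESIS `hB` (spelled out), so that this file does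
not wait for it; the closed forms are one-line specialisations once part II is in the tree.
* `portCyclic_anyClassNumber_of_controlGlue (h161 h411 hKS hB)` — `HeegnerMuPartOfPrintKS.portCyclic_of_ks` VERBATIM with STUB A :=
  part I's `howardInputsCore_anyClassNumber h411` and the shorter binder prefix `hyp → irr_ℚ → irr_K → Heeg_p`;
* **`exists_coherentPair_isTorsion_muIneq_of_howard_kolyvaginSystem_anyClassNumber_of_controlGlue (h161 h411 hB)`** — x9-p1 LEAD
  g7's p689159 §2 `HeegnerStabilizedOfKSLeaf.exists_coherentPair_isTorsion_muIneq_of_howard_kolyvaginSystem` VERBATIM with the three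
  idle hypotheses deleted: on EVERY `Thm413Hypotheses` frame with (irr_ℚ), (irr_K), (Heeg_p), `p ∤ N`, the sharp tower and
  `[K[p] : K[1]] = p − 1` — ANY CLASS NUMBER — there are the engine's `C`, `F` on `(Dt, β)` with both envelopes, the torsion clause
  (`Module.Finite 𝔖 → finrank 𝔖 = 1 → 𝔖` torsion-free ∧ `𝔖/Λκ_∞(C)` torsion) and the μ-inequality clause.
Consequence (part IV, `PrintX10bBeyondCarrierOfTenPrintLeaves`): on crux 23055 the `3 ∤ h_K` frames run through the same road as the
`3 ∣ h_K` frames, and Mastella–Zerman 2026 Cor. 4.6 leaves the census (ten cite-only leaves).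
HONEST FRAMING: conditional on F-161 / F-411 (statement-only Literature facts) and on `hB`; «beyond-print theorem»: no; no summit
statement is proved; BSD is NOT proved by any of this.

References: [Howard2004HeegnerKolyvagin] Thm. 1.6.1, proof of Thm. 2.2.10 (𝔮 = T^m + p); [CastellaGrossiLeeSkinner2022] Thm. 4.1.1,
Rem. 4.1.4, §3.2/§4.1 (no class-number hypothesis); [PerrinRiou1987BSMF] §3.4 Prop. 10.
-/

set_option linter.dupNamespace false
set_option autoImplicit false

noncomputable section

open scoped Classical Pointwise ContRepresentation TensorProduct NumberField

open Function NumberField IsDedekindDomain Field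
open Literature Literature.NumberTheory.EllipticCurves WeierstrassCurve
open Literature.NumberTheory.EllipticCurves.ModularForms
open Literature.NumberTheory.EllipticCurves.CastellaGrossiLeeSkinner2022
open Literature.NumberTheory.GaloisCohomology Literature.NumberTheory.GaloisCohomology.Howard2004
open Literature.NumberTheory.Automorphic
open Literature.NumberTheory.GaloisRepresentations Literature.NumberTheory.GaloisRepresentations.DiscreteGaloisModule
open Summit.BirchSwinnertonDyer.BirchSwinnertonDyer.Theorems
open Summit.BirchSwinnertonDyer.BirchSwinnertonDyer.Theorems.HeegnerMuPartControlGlue (Stmt.kummerStrictOnFrames)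
open Summit.BirchSwinnertonDyer.BirchSwinnertonDyer.Theorems.HeegnerStabilizedOfKSLeaf
  (torsionFree_and_isTorsion_quotient_of_kolyvaginSystemLeaf)

namespace Summit.BirchSwinnertonDyer.BirchSwinnertonDyer.Theorems.HeegnerMuPartKSAnyClassNumber

/-! ## §1 The cyclic port for any class number, modulo the control-glue letter -/

set_option synthInstance.maxHeartbeats 80000 in
/-- **The cyclic port (`HasSpecWitnesses` at every Eisenstein prime `𝔮_m`, `m ≫ 0`) from Howard Thm. 1.6.1 (`h161`), CGLS Thm. 4.1.1
(`h411`), the frame-restricted Kummer = strict letter (`hKS`) and the control glue WITHOUT idle binders (`hB`), for ANY class number.**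
Proof = `HeegnerMuPartOfPrintKS.portCyclic_of_ks` verbatim, STUB A := `howardInputsCore_anyClassNumber h411`.
[cite: Howard2004HeegnerKolyvagin, Thm. 1.6.1 and Thm. 2.2.10 (proof)] [cite: CastellaGrossiLeeSkinner2022, Thm. 4.1.1 and Rem. 4.1.4] -/
theorem portCyclic_anyClassNumber_of_controlGlue
    (h161 : Literature.NumberTheory.GaloisCohomology.Howard2004.thm161_dvrKolyvaginBound)
    (h411 : Literature.NumberTheory.EllipticCurves.CastellaGrossiLeeSkinner2022.thm411_exists_kolyvaginSystem_one_ne_zero)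
    (hKS : Stmt.kummerStrictOnFrames)
    (hB : Stmt.kummerStrictOnFrames →
    ∀ (N : ℕ) [NeZero N] (W : WeierstrassCurve ℚ) [W.IsGloballyMinimal] (K : Type) [Field K] [NumberField K]
      (p : ℕ) [Fact p.Prime] (κ : ZpExtension K p) (γ : Field.absoluteGaloisGroup K)
      (jbar : AlgebraicClosure K →+* ℂ) (hyp : CastellaGrossiLeeSkinner2022.Thm413Hypotheses N W K p κ γ),
      W.HasIrreducibleModPGaloisRep p → (W.baseChange K).HasIrreducibleModPGaloisRep p →
      SatisfiesHeegnerHypothesis p K →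
      ∀ (D : (W.baseChange K).LambdaAdicSelmerData κ γ)
        (C : CastellaGrossiLeeSkinner2022.StabilizedHeegnerData N W K κ jbar)
        (X : (W.baseChange K).SelmerDualData κ γ) (z : D.S),
      (∀ (k : ℕ) (hk : C.depth < k), D.proj k z ∈ CastellaGrossiLeeSkinner2022.stabilizedClassLayer C k hk) →
      CastellaGrossiLeeSkinner2022.stabilizedHeegnerModule D C = Submodule.span (IwasawaAlgebra p) {z} →
      Module.Finite (IwasawaAlgebra p) D.S → Module.Finite (IwasawaAlgebra p) X.X →
      Module.IsTorsion (IwasawaAlgebra p) (D.S ⧸ CastellaGrossiLeeSkinner2022.stabilizedHeegnerModule D C) →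
      z ≠ 0 →
      ∃ c m₁ : ℕ, ∀ (m : ℕ) (hm : 1 ≤ m), m₁ ≤ m →
        haveI := hyp.isElliptic
        letI := IwasawaAlgebra.isDomain_quotient_X_pow_add_C p hm
        letI := IwasawaAlgebra.isDiscreteValuationRing_quotient_X_pow_add_C p hm
        haveI := IwasawaAlgebra.EisensteinCoeff.isLocalRing_succ p hm
        letI := IwasawaAlgebra.EisensteinCoeff.algebraOfSpecSucc p m
        haveI := W.isScalarTower_algebraOfSpecSucc (K := K) (p := p) (m := m)
        letI := W.residueModuleSucc (K := K) (p := p) hm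
        ∀ (S : Finset (IsDedekindDomain.HeightOneSpectrum (NumberField.RingOfIntegers K)))
          (hpS : ∀ v, ((p : ℕ) : NumberField.RingOfIntegers K) ∈ v.asIdeal → v ∈ S)
          (hbad : ∀ v, v ∉ S → ((p : ℕ) : NumberField.RingOfIntegers K) ∉ v.asIdeal →
            (W.baseChange K).HasGoodReductionAt v)
          (_hSN : ∀ v ∈ S, ((p : ℕ) : NumberField.RingOfIntegers K) ∈ v.asIdeal ∨
            ((N : ℕ) : NumberField.RingOfIntegers K) ∈ v.asIdeal)
          (_hSσ : ∀ (σ : K ≃ₐ[ℚ] K) (v : IsDedekindDomain.HeightOneSpectrum (NumberField.RingOfIntegers K)),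
            σ • v ∈ S → v ∈ S)
          (L : Set (IsDedekindDomain.HeightOneSpectrum (NumberField.RingOfIntegers K)))
          (hL : L ⊆ (W.eisensteinTower (κ.unitTwist (-1)) hm).degreeTwoPrimes p)
          (hLS : ∀ v ∈ L, v ∉ S) (jbar' : AlgebraicClosure K →+* ℂ) (cd : ConjugationDatum K)
          (Dd : ∀ k, DualityDatum p cd ((W.eisensteinTower (κ.unitTwist (-1)) hm).ρ k)
            (IwasawaAlgebra.EisensteinCoeff p m (k + 1)))
          (fs : ∀ (k : ℕ) (n : Finset (IsDedekindDomain.HeightOneSpectrum (NumberField.RingOfIntegers K)))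
            (v : IsDedekindDomain.HeightOneSpectrum (NumberField.RingOfIntegers K)),
            galoisCohomology ((W.eisensteinLevelQuot (κ.unitTwist (-1)) hm k n).toLocal (Sum.inr v)) 1 →+
              SingularQuotient (GaloisRep.toLocal v (W.eisensteinLevelQuot (κ.unitTwist (-1)) hm k n)) ⊗[ℤ]
                Gell v)
          (t : ∀ k, ((W.baseChange K).torsionGaloisModule ((p : ℤ) ^ (k + 1))).toContRepresentation →ⁱL
            ((W.baseChange K).torsionGaloisModule ((p : ℤ) ^ k)).toContRepresentation)
          (ht : ∀ k (P : geomTorsion (W.baseChange K) ((p : ℤ) ^ (k + 1))),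
            t k P = (W.baseChange K).geomTorsionReduce p k P)
          (I : ZpExtension.EisensteinH1Data (κ.unitTwist (-1))
            (fun k ↦ (W.baseChange K).torsionGaloisModule ((p : ℤ) ^ k)) t hm)
          (hy : (W.eisensteinDVRSetting (κ.unitTwist (-1)) hm S hpS hbad L hL hLS jbar' cd Dd fs).SatisfiesH),
          (W.eisensteinDVRSetting (κ.unitTwist (-1)) hm S hpS hbad L hL hLS jbar' cd Dd fs).Conclusion hy
              (fun k ↦ I.proj (k + 1) (D.toEisensteinH1Linear hm t ht I hyp.topGenerator hyp.noPTorsion z)) →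
            Nonempty (HeegnerMuPartStabilized.SpecWitness (IwasawaAlgebra p) D.S X.X
              (CastellaGrossiLeeSkinner2022.stabilizedHeegnerModule D C)
              (PowerSeries.X ^ m + PowerSeries.C (p : ℤ_[p]) : IwasawaAlgebra p) (p ^ c))) :
    ∀ (N : ℕ) [NeZero N] (W : WeierstrassCurve ℚ) [W.IsGloballyMinimal] (K : Type) [Field K] [NumberField K]
      (p : ℕ) [Fact p.Prime] (κ : ZpExtension K p) (γ : Field.absoluteGaloisGroup K)
      (jbar : AlgebraicClosure K →+* ℂ),
      CastellaGrossiLeeSkinner2022.Thm413Hypotheses N W K p κ γ →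
      W.HasIrreducibleModPGaloisRep p → (W.baseChange K).HasIrreducibleModPGaloisRep p →
      SatisfiesHeegnerHypothesis p K →
      ∀ (D : (W.baseChange K).LambdaAdicSelmerData κ γ)
        (C : CastellaGrossiLeeSkinner2022.StabilizedHeegnerData N W K κ jbar)
        (X : (W.baseChange K).SelmerDualData κ γ) (z : D.S),
      (∀ (k : ℕ) (hk : C.depth < k), D.proj k z ∈ CastellaGrossiLeeSkinner2022.stabilizedClassLayer C k hk) →
      CastellaGrossiLeeSkinner2022.stabilizedHeegnerModule D C = Submodule.span (IwasawaAlgebra p) {z} →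
      Module.Finite (IwasawaAlgebra p) D.S → Module.Finite (IwasawaAlgebra p) X.X →
      Module.IsTorsion (IwasawaAlgebra p) (D.S ⧸ CastellaGrossiLeeSkinner2022.stabilizedHeegnerModule D C) →
      HeegnerMuPartStabilized.HasSpecWitnesses p D.S X.X (CastellaGrossiLeeSkinner2022.stabilizedHeegnerModule D C) := by
  intro N _ W _ K _ _ p _ κ γ jbar hyp hirr hirrK hHp D C X z hz hcyc hfinS hfinX htor
  obtain ⟨m₀, hA⟩ := HeegnerMuPartKSAnyClassNumber.howardInputsCore_anyClassNumber h411 N W K p κ γ jbar hyp hirr hirrK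
    hHp D C X z hz hcyc hfinS hfinX htor
  -- `z ≠ 0` from STUB A at the level `max m₀ 1`: the Kolyvagin system's bottom class is `ctrlLevel … z`, non-zero
  have hz0 : z ≠ 0 := by
    have hm' : 1 ≤ max m₀ 1 := le_max_right _ _
    haveI := hyp.isElliptic
    letI := IwasawaAlgebra.isDomain_quotient_X_pow_add_C p hm'
    letI := IwasawaAlgebra.isDiscreteValuationRing_quotient_X_pow_add_C p hm'
    haveI := IwasawaAlgebra.EisensteinCoeff.isLocalRing_succ p hm'
    letI := IwasawaAlgebra.EisensteinCoeff.algebraOfSpecSucc p (max m₀ 1)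
    haveI := W.isScalarTower_algebraOfSpecSucc (K := K) (p := p) (m := max m₀ 1)
    letI := W.residueModuleSucc (K := K) (p := p) hm'
    obtain ⟨_S₀, _hpS₀, _hbad₀, _hSN₀, _hSσ₀, _L₀, _hL₀, _hLS₀, _jbar₀, _cd₀, _Dd₀, _fs₀, _t₀, _ht₀, _I₀, _hy₀, κ₀, _hlarge₀,
      hone₀, hlink₀⟩ := hA (max m₀ 1) hm' (le_max_left _ _)
    intro hz
    subst hz
    exact hone₀ (funext fun k ↦ by
      rw [hlink₀ k, Pi.zero_apply, map_zero, map_zero]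
      rfl)
  obtain ⟨c, m₁, hB⟩ :=
    hB hKS N W K p κ γ jbar hyp hirr hirrK hHp D C X z hz hcyc hfinS hfinX htor hz0
  refine ⟨c, max (max m₀ m₁) 1, fun m hm' ↦ ?_⟩
  have hm : 1 ≤ m := le_trans (le_max_right _ _) hm'
  have hm0 : m₀ ≤ m := le_trans ((le_max_left _ _).trans (le_max_left _ _)) hm'
  have hm1 : m₁ ≤ m := le_trans ((le_max_right _ _).trans (le_max_left _ _)) hm'
  haveI := hyp.isElliptic
  letI := IwasawaAlgebra.isDomain_quotient_X_pow_add_C p hm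
  letI := IwasawaAlgebra.isDiscreteValuationRing_quotient_X_pow_add_C p hm
  haveI := IwasawaAlgebra.EisensteinCoeff.isLocalRing_succ p hm
  letI := IwasawaAlgebra.EisensteinCoeff.algebraOfSpecSucc p m
  haveI := W.isScalarTower_algebraOfSpecSucc (K := K) (p := p) (m := m)
  letI := W.residueModuleSucc (K := K) (p := p) hm
  obtain ⟨S, hpS, hbad, hSN, hSσ, L, hL, hLS, jbar', cd, Dd, fs, t, ht, I, hy, κKS, hlarge, hone, hlink⟩ := hA m hm hm0
  have hconc := h161 p K _ _ _ _ _ (W.eisensteinDVRSetting (κ.unitTwist (-1)) hm S hpS hbad L hL hLS jbar' cd Dd fs)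
    κKS hy hlarge hone
  have hone_eq : κKS.one =
      fun k ↦ I.proj (k + 1) (D.toEisensteinH1Linear hm t ht I hyp.topGenerator hyp.noPTorsion z) :=
    funext hlink
  rw [hone_eq] at hconc
  exact hB m hm hm1 S hpS hbad hSN hSσ L hL hLS jbar' cd Dd fs t ht I hy hconc

/-! ## §2 The coherent-pair μ-letter with torsion, any class number, modulo the control-glue letter -/

/-- **The coherent-pair μ-letter L∃ with its torsion clause, from F-161 and F-411, for ANY CLASS NUMBER** (modulo the control glue
`hB` without idle binders): p689159 §2 verbatim with `¬ W.HasCM`, `HasPadicScalarImage`, `p ∣ h_K` deleted — the engine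
`exists_coherent_pair_envelope_class`, the torsion clause `torsionFree_and_isTorsion_quotient_of_kolyvaginSystemLeaf` (F-411 + rank one)
and the cyclic port §1 fed with the kernel letter `HeegnerMuPartControlGlue.kummerStrictOnFrames_holds`, then
`HeegnerMuPartStabilized.lengthAt_torsion_le_two_mul_of_hasSpecWitnesses`.
[cite: Howard2004HeegnerKolyvagin, Thm. 1.6.1 and proof of Thm. 2.2.10] [cite: CastellaGrossiLeeSkinner2022, Thm. 4.1.1 and Rem. 4.1.4]
[cite: PerrinRiou1987BSMF, §3.4 Prop. 10] -/
theorem exists_coherentPair_isTorsion_muIneq_of_howard_kolyvaginSystem_anyClassNumber_of_controlGlue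
    (h161 : thm161_dvrKolyvaginBound) (hKS : thm411_exists_kolyvaginSystem_one_ne_zero)
    (hB : Stmt.kummerStrictOnFrames →
    ∀ (N : ℕ) [NeZero N] (W : WeierstrassCurve ℚ) [W.IsGloballyMinimal] (K : Type) [Field K] [NumberField K]
      (p : ℕ) [Fact p.Prime] (κ : ZpExtension K p) (γ : Field.absoluteGaloisGroup K)
      (jbar : AlgebraicClosure K →+* ℂ) (hyp : CastellaGrossiLeeSkinner2022.Thm413Hypotheses N W K p κ γ),
      W.HasIrreducibleModPGaloisRep p → (W.baseChange K).HasIrreducibleModPGaloisRep p →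
      SatisfiesHeegnerHypothesis p K →
      ∀ (D : (W.baseChange K).LambdaAdicSelmerData κ γ)
        (C : CastellaGrossiLeeSkinner2022.StabilizedHeegnerData N W K κ jbar)
        (X : (W.baseChange K).SelmerDualData κ γ) (z : D.S),
      (∀ (k : ℕ) (hk : C.depth < k), D.proj k z ∈ CastellaGrossiLeeSkinner2022.stabilizedClassLayer C k hk) →
      CastellaGrossiLeeSkinner2022.stabilizedHeegnerModule D C = Submodule.span (IwasawaAlgebra p) {z} →
      Module.Finite (IwasawaAlgebra p) D.S → Module.Finite (IwasawaAlgebra p) X.X →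
      Module.IsTorsion (IwasawaAlgebra p) (D.S ⧸ CastellaGrossiLeeSkinner2022.stabilizedHeegnerModule D C) →
      z ≠ 0 →
      ∃ c m₁ : ℕ, ∀ (m : ℕ) (hm : 1 ≤ m), m₁ ≤ m →
        haveI := hyp.isElliptic
        letI := IwasawaAlgebra.isDomain_quotient_X_pow_add_C p hm
        letI := IwasawaAlgebra.isDiscreteValuationRing_quotient_X_pow_add_C p hm
        haveI := IwasawaAlgebra.EisensteinCoeff.isLocalRing_succ p hm
        letI := IwasawaAlgebra.EisensteinCoeff.algebraOfSpecSucc p m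
        haveI := W.isScalarTower_algebraOfSpecSucc (K := K) (p := p) (m := m)
        letI := W.residueModuleSucc (K := K) (p := p) hm
        ∀ (S : Finset (IsDedekindDomain.HeightOneSpectrum (NumberField.RingOfIntegers K)))
          (hpS : ∀ v, ((p : ℕ) : NumberField.RingOfIntegers K) ∈ v.asIdeal → v ∈ S)
          (hbad : ∀ v, v ∉ S → ((p : ℕ) : NumberField.RingOfIntegers K) ∉ v.asIdeal →
            (W.baseChange K).HasGoodReductionAt v)
          (_hSN : ∀ v ∈ S, ((p : ℕ) : NumberField.RingOfIntegers K) ∈ v.asIdeal ∨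
            ((N : ℕ) : NumberField.RingOfIntegers K) ∈ v.asIdeal)
          (_hSσ : ∀ (σ : K ≃ₐ[ℚ] K) (v : IsDedekindDomain.HeightOneSpectrum (NumberField.RingOfIntegers K)),
            σ • v ∈ S → v ∈ S)
          (L : Set (IsDedekindDomain.HeightOneSpectrum (NumberField.RingOfIntegers K)))
          (hL : L ⊆ (W.eisensteinTower (κ.unitTwist (-1)) hm).degreeTwoPrimes p)
          (hLS : ∀ v ∈ L, v ∉ S) (jbar' : AlgebraicClosure K →+* ℂ) (cd : ConjugationDatum K)
          (Dd : ∀ k, DualityDatum p cd ((W.eisensteinTower (κ.unitTwist (-1)) hm).ρ k)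
            (IwasawaAlgebra.EisensteinCoeff p m (k + 1)))
          (fs : ∀ (k : ℕ) (n : Finset (IsDedekindDomain.HeightOneSpectrum (NumberField.RingOfIntegers K)))
            (v : IsDedekindDomain.HeightOneSpectrum (NumberField.RingOfIntegers K)),
            galoisCohomology ((W.eisensteinLevelQuot (κ.unitTwist (-1)) hm k n).toLocal (Sum.inr v)) 1 →+
              SingularQuotient (GaloisRep.toLocal v (W.eisensteinLevelQuot (κ.unitTwist (-1)) hm k n)) ⊗[ℤ]
                Gell v)
          (t : ∀ k, ((W.baseChange K).torsionGaloisModule ((p : ℤ) ^ (k + 1))).toContRepresentation →ⁱL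
            ((W.baseChange K).torsionGaloisModule ((p : ℤ) ^ k)).toContRepresentation)
          (ht : ∀ k (P : geomTorsion (W.baseChange K) ((p : ℤ) ^ (k + 1))),
            t k P = (W.baseChange K).geomTorsionReduce p k P)
          (I : ZpExtension.EisensteinH1Data (κ.unitTwist (-1))
            (fun k ↦ (W.baseChange K).torsionGaloisModule ((p : ℤ) ^ k)) t hm)
          (hy : (W.eisensteinDVRSetting (κ.unitTwist (-1)) hm S hpS hbad L hL hLS jbar' cd Dd fs).SatisfiesH),
          (W.eisensteinDVRSetting (κ.unitTwist (-1)) hm S hpS hbad L hL hLS jbar' cd Dd fs).Conclusion hy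
              (fun k ↦ I.proj (k + 1) (D.toEisensteinH1Linear hm t ht I hyp.topGenerator hyp.noPTorsion z)) →
            Nonempty (HeegnerMuPartStabilized.SpecWitness (IwasawaAlgebra p) D.S X.X
              (CastellaGrossiLeeSkinner2022.stabilizedHeegnerModule D C)
              (PowerSeries.X ^ m + PowerSeries.C (p : ℤ_[p]) : IwasawaAlgebra p) (p ^ c))) :
    ∀ (N : ℕ) [NeZero N] (W : WeierstrassCurve ℚ) [W.IsGloballyMinimal] (K : Type) [Field K] [NumberField K]
      (p : ℕ) [Fact p.Prime] (κ : ZpExtension K p) (γ : Field.absoluteGaloisGroup K)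
      (jbar : AlgebraicClosure K →+* ℂ),
      Thm413Hypotheses N W K p κ γ →
      W.HasIrreducibleModPGaloisRep p → (W.baseChange K).HasIrreducibleModPGaloisRep p →
      SatisfiesHeegnerHypothesis p K →
      ¬ p ∣ N →
      (∀ k, ringClassSubgroup K (p ^ (k + 1)) jbar ≤ κ.layerSubgroup k) →
      Nat.card (ringClassGalOver (jbar.comp (algebraMap K (AlgebraicClosure K))) p 1) = p - 1 →
      ∀ (Dt : ModularParametrizationData W N) (β : ℤ), (4 * N : ℤ) ∣ β ^ 2 - NumberField.discr K →
      ∀ (D : (W.baseChange K).LambdaAdicSelmerData κ γ) (X : (W.baseChange K).SelmerDualData κ γ),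
      ∃ (C : StabilizedHeegnerData N W K κ jbar) (F : HeegnerFamily N W K κ jbar),
        C.Dt = Dt ∧ F.Dt = Dt ∧ C.β = β ∧ F.β = β ∧
        heegnerModule D F ≤ stabilizedHeegnerModule D C ∧
        (∃ g : IwasawaAlgebra p, g ≠ 0 ∧ g • stabilizedHeegnerModule D C ≤ heegnerModule D F) ∧
        (Module.Finite (IwasawaAlgebra p) D.S → Module.finrank (IwasawaAlgebra p) D.S = 1 →
          NoZeroSMulDivisors (IwasawaAlgebra p) D.S ∧
            Module.IsTorsion (IwasawaAlgebra p) (D.S ⧸ stabilizedHeegnerModule D C)) ∧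
        (Module.Finite (IwasawaAlgebra p) D.S → Module.Finite (IwasawaAlgebra p) X.X →
          Module.finrank (IwasawaAlgebra p) D.S = 1 →
          ∀ 𝔭 : PrimeSpectrum (IwasawaAlgebra p), 𝔭.asIdeal = Ideal.span {(p : IwasawaAlgebra p)} →
            Module.lengthAt (IwasawaAlgebra p) (Submodule.torsion (IwasawaAlgebra p) X.X) 𝔭 ≤
              2 * Module.lengthAt (IwasawaAlgebra p) (D.S ⧸ stabilizedHeegnerModule D C) 𝔭) := by
  intro N _ W _ K _ _ p _ κ γ jbar hyp hirr hirrK hHp hpN hTw1 hcardp Dt β hβ D X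
  have hlev : N = W.conductorNorm ℤ := hyp.level
  subst hlev
  haveI : W.IsElliptic := hyp.isElliptic
  -- the engine's coherent pair `(C, F)` on `(Dt, β)` WITH its class `z = κ_∞`
  obtain ⟨C, F, hCDt, hFDt, hCβ, hFβ, hfwd, hrev, z, hz, hcyc⟩ :=
    exists_coherent_pair_envelope_class (W := W) hyp.isImaginaryQuadratic hyp.heegner Dt hβ jbar hyp.ordinary hpN κ
      hyp.topGenerator hTw1 hcardp hyp.noPTorsion D
  refine ⟨C, F, hCDt, hFDt, hCβ, hFβ, hfwd, hrev, fun hfinS hS1 ↦ ?_, fun hfinS hfinX hS1 𝔭 h𝔭 ↦ ?_⟩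
  · haveI := hfinS
    exact torsionFree_and_isTorsion_quotient_of_kolyvaginSystemLeaf hKS hyp jbar D C hz hcyc hS1
  · haveI := hfinS
    haveI := hfinX
    obtain ⟨-, htorC⟩ := torsionFree_and_isTorsion_quotient_of_kolyvaginSystemLeaf hKS hyp jbar D C hz hcyc hS1
    -- the specialised witnesses at `(D, C, X, κ_∞)` from the landed KS-port and the kernel letters of CG-FRAME
    have hW := portCyclic_anyClassNumber_of_controlGlue h161 hKS HeegnerMuPartControlGlue.kummerStrictOnFrames_holds hB
      (W.conductorNorm ℤ) W K p κ γ jbar hyp hirr hirrK hHp D C X z hz hcyc hfinS hfinX htorC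
    exact HeegnerMuPartStabilized.lengthAt_torsion_le_two_mul_of_hasSpecWitnesses p _ htorC hW 𝔭 h𝔭

end Summit.BirchSwinnertonDyer.BirchSwinnertonDyer.Theorems.HeegnerMuPartKSAnyClassNumber

end
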